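import Mathlib
import Summits.ValiantsHypothesis.ValiantsHypothesis.Theorems.LiouvilleSarnakAlignedTypeICharactersMod2nBilinearSieveKorobovPostnikov
import HarnessLib

/-!
# Route LiouvilleSarnak — support `AlignedTypeI` (stmt-ValiantsHypothesis-21040), line `characters_mod_2n`:
# the parameter choice for the Postnikov–Gallagher–Korobov block bound

Brick (B5a) of `HS` (short character sums mod `q = 2^j`).  The block bound `norm_charSum_Ioc_le_of_params`
(`…KorobovBlock.lean`) holds under explicit side conditions on the Korobov parameters.  Here they are verified for
the concrete choice (with `j log 2 = Y L`, i.e. `Y = log q/log N`, `L = log N`, in the main range `Y ≥ 10`,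
`L ≥ 10⁶ Y²`):

  `r = ⌊5.01Y⌋`, `k = 5r²`, `τ = ⌊j/(r+1)⌋ + 2`, `a = ⌊e^{0.39L}⌋`, good `m ∈ (⌊2Y⌋, ⌊3.5Y⌋]`.

* `params_basic` — `4.91Y ≤ r ≤ 5.01Y`, `r ≥ 50`, `2 ≤ τ`, `τ + 1 ≤ j`, `r ≤ j`, `1 ≤ a ≤ e^{0.4L}`, `M₃ ≤ r`,
  `M₃ − M₂ ∈ [1.5Y − 1, 1.5Y + 1]`;
* `params_trunc` — the truncation condition `j + v₂(m) ≤ τm` for `r < m ≤ j`;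
* `params_err` — the Gallagher error `2·2^τ a² ≤ 8 e^{0.98 L}`;
* `params_good` — ★ the good indices: for `⌊2Y⌋ < m ≤ ⌊3.5Y⌋`, `τm < j + v₂(m)`, `2^{e_m} ≤ k a^m` and
  `(4 + log 2^{e_m})/2^{e_m} ≤ θ*(L, Y) = L e^{21Y − 0.3YL}`, `e_m = j + v₂(m) − τm` (the exponent `0.3` is met
  exactly: `e_m ≥ j(1 − m/(r+1)) − 2m ≥ 0.3j − 7Y` as `m/(r+1) ≤ 3.5Y/5.01Y < 0.7`).

What remains for `HS`: feed these into `norm_charSum_Ioc_le_of_params` (transport `χ` mod `2^j` to mod `2^{n+τ}`,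
`n = j − τ`) and cover all `N ≤ q` (blocks of length `q^{1/10}`, trivial range).

HONEST FRAMING. Helper lemmas only (unconditional, numbers only); the leaf `AlignedTypeI` is NOT closed here; nothing
bears on `VP ≠ VNP` (NOT proved).
-/

set_option linter.dupNamespace false

noncomputable section

namespace Summit.ValiantsHypothesis.ValiantsHypothesis.Theorems.LiouvilleSarnak.AlignedTypeI.CharactersModTwoN

open Finset Real
open Literature.NumberTheory.LFunctions
open Literature.NumberTheory.LFunctions.VKZeta (thetaStar)

/-! ### Elementary facts -/

/-- `v₂(m) < m` for `m ≥ 1`. [folklore] -/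
theorem padicValNat_two_lt_self {m : ℕ} (hm : 1 ≤ m) : padicValNat 2 m < m := by
  have h1 := padicValNat_le_nat_log (p := 2) m
  have h2 : Nat.log 2 m < m := Nat.log_lt_self 2 (by omega)
  omega

/-- From `j log 2 = Y L`, `Y ≥ 10`, `L ≥ 10⁶Y²`: `L ≥ 10⁸`, `Y L ≤ j ≤ 2 Y L` and `10⁹ ≤ j`. [folklore] -/
theorem j_bounds {j : ℕ} {L Y : ℝ} (hY : 10 ≤ Y) (hL : (10 : ℝ) ^ 6 * Y ^ 2 ≤ L)
    (hj : (j : ℝ) * Real.log 2 = Y * L) :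
    (10 : ℝ) ^ 8 ≤ L ∧ Y * L ≤ j ∧ (j : ℝ) ≤ 2 * (Y * L) ∧ (10 : ℝ) ^ 9 ≤ j := by
  have hY0 : 0 < Y := by linarith
  have hL8 : (10 : ℝ) ^ 8 ≤ L := by nlinarith
  have hl2 := Real.log_two_lt_d9
  have hl1 := Real.log_two_gt_d9
  have hYL : 0 ≤ Y * L := by positivity
  have hj1 : Y * L ≤ j := by nlinarith
  have hj2 : (j : ℝ) ≤ 2 * (Y * L) := by nlinarith
  refine ⟨hL8, hj1, hj2, ?_⟩
  nlinarith

/-! ### The basic parameter inequalities -/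

/-- **Basic inequalities** for `r = ⌊5.01Y⌋`, `τ = ⌊j/(r+1)⌋ + 2`, `a = ⌊e^{0.39L}⌋`, `M₂ = ⌊2Y⌋`, `M₃ = ⌊3.5Y⌋`.
[cite: Ivic1985, Theorem 6.2 (proof, p. 147 and p. 158)] -/
theorem params_basic {j r τ a M₂ M₃ : ℕ} {L Y : ℝ} (hY : 10 ≤ Y) (hL : (10 : ℝ) ^ 6 * Y ^ 2 ≤ L)
    (hj : (j : ℝ) * Real.log 2 = Y * L) (hr : r = ⌊5.01 * Y⌋₊) (hτ : τ = j / (r + 1) + 2)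
    (ha : a = ⌊Real.exp (0.39 * L)⌋₊) (hM₂ : M₂ = ⌊2 * Y⌋₊) (hM₃ : M₃ = ⌊3.5 * Y⌋₊) :
    4.91 * Y ≤ r ∧ (r : ℝ) ≤ 5.01 * Y ∧ 50 ≤ r ∧ 2 ≤ τ ∧ τ + 1 ≤ j ∧ r ≤ j ∧ 1 ≤ a ∧
      (a : ℝ) ≤ Real.exp (0.4 * L) ∧ M₃ ≤ r ∧
      1.5 * Y - 1 ≤ ((M₃ - M₂ : ℕ) : ℝ) ∧ ((M₃ - M₂ : ℕ) : ℝ) ≤ 1.5 * Y + 1 := by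
  obtain ⟨hL8, hj1, hj2, hj9⟩ := j_bounds hY hL hj
  have hY0 : 0 < Y := by linarith
  -- `r`
  have hr_le : (r : ℝ) ≤ 5.01 * Y := by rw [hr]; exact Nat.floor_le (by positivity)
  have hr_gt : 5.01 * Y < (r : ℝ) + 1 := by rw [hr]; exact Nat.lt_floor_add_one _
  have hr1 : 4.91 * Y ≤ r := by linarith
  have hr50R : (49 : ℝ) < r := by linarith
  have hr50 : 50 ≤ r := by
    have : 49 < r := by exact_mod_cast hr50R
    omega
  -- `τ`
  have hτ2 : 2 ≤ τ := by rw [hτ]; exact Nat.le_add_left 2 _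
  have hj9N : 10 ^ 9 ≤ j := by exact_mod_cast hj9
  have hdiv : j / (r + 1) ≤ j / 51 := Nat.div_le_div_left (by omega) (by norm_num)
  have hdiv2 : j / 51 < j - 2 := by
    have := Nat.div_le_self j 51
    have h51 : j / 51 * 51 ≤ j := Nat.div_mul_le_self j 51
    omega
  have hτj : τ + 1 ≤ j := by rw [hτ]; omega
  -- `r ≤ j`
  have hrj : r ≤ j := by
    have : (r : ℝ) ≤ j := by nlinarith
    exact_mod_cast this
  -- `a`
  have hexp1 : 1 ≤ Real.exp (0.39 * L) := Real.one_le_exp (by positivity)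
  have ha1 : 1 ≤ a := by rw [ha]; exact Nat.one_le_floor_iff _ |>.2 hexp1
  have hahi : (a : ℝ) ≤ Real.exp (0.4 * L) := by
    rw [ha]
    refine (Nat.floor_le (by positivity)).trans ?_
    exact Real.exp_le_exp.2 (by nlinarith)
  -- `M₂`, `M₃`
  have hM3r : M₃ ≤ r := by rw [hM₃, hr]; exact Nat.floor_mono (by nlinarith)
  have hM23 : M₂ ≤ M₃ := by rw [hM₂, hM₃]; exact Nat.floor_mono (by nlinarith)
  have hM2_le : (M₂ : ℝ) ≤ 2 * Y := by rw [hM₂]; exact Nat.floor_le (by positivity)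
  have hM2_gt : 2 * Y < (M₂ : ℝ) + 1 := by rw [hM₂]; exact Nat.lt_floor_add_one _
  have hM3_le : (M₃ : ℝ) ≤ 3.5 * Y := by rw [hM₃]; exact Nat.floor_le (by positivity)
  have hM3_gt : 3.5 * Y < (M₃ : ℝ) + 1 := by rw [hM₃]; exact Nat.lt_floor_add_one _
  have hcast : ((M₃ - M₂ : ℕ) : ℝ) = (M₃ : ℝ) - M₂ := by rw [Nat.cast_sub hM23]
  refine ⟨hr1, hr_le, hr50, hτ2, hτj, hrj, ha1, hahi, hM3r, ?_, ?_⟩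
  · rw [hcast]; linarith
  · rw [hcast]; linarith

/-! ### The truncation condition -/

/-- **Truncation**: with `τ = ⌊j/(r+1)⌋ + 2`, for `r < m`: `j + v₂(m) ≤ τ m`
(`(r+1)(τ−1) > j` and `v₂(m) < m`). [folklore] -/
theorem params_trunc {j r τ : ℕ} (hτ : τ = j / (r + 1) + 2) (m : ℕ) (hrm : r < m) :
    j + padicValNat 2 m ≤ τ * m := by
  -- `τ = t + 1` with `t = ⌊j/(r+1)⌋ + 1`, and `(r+1) t > j`
  set t : ℕ := j / (r + 1) + 1 with ht
  have hτt : τ = t + 1 := by rw [hτ, ht]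
  have h1 : j < (r + 1) * t := Nat.lt_mul_div_succ j (Nat.succ_pos r)
  have h3 : (r + 1) * t ≤ m * t := Nat.mul_le_mul_right _ (by omega)
  have hv : padicValNat 2 m < m := padicValNat_two_lt_self (by omega)
  have h4 : τ * m = m * t + m := by rw [hτt]; ring
  rw [h4]
  omega

/-! ### The Gallagher error term -/

/-- **The error term**: `2 · 2^τ · a² ≤ 8 e^{0.98 L}` (`2^τ ≤ 4·2^{j/(r+1)} ≤ 4 e^{0.2L}`, `a ≤ e^{0.39L}`).
[folklore] -/
theorem params_err {j r τ a : ℕ} {L Y : ℝ} (hY : 10 ≤ Y) (hL : (10 : ℝ) ^ 6 * Y ^ 2 ≤ L)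
    (hj : (j : ℝ) * Real.log 2 = Y * L) (hr : r = ⌊5.01 * Y⌋₊) (hτ : τ = j / (r + 1) + 2)
    (ha : a = ⌊Real.exp (0.39 * L)⌋₊) :
    2 * ((2 ^ τ : ℕ) : ℝ) * (a : ℝ) ^ 2 ≤ 8 * Real.exp (0.98 * L) := by
  have hY0 : 0 < Y := by linarith
  have hr_gt : 5.01 * Y < (r : ℝ) + 1 := by rw [hr]; exact Nat.lt_floor_add_one _
  have hr0 : (0 : ℝ) < (r : ℝ) + 1 := by positivity
  -- `τ ≤ j/(r+1) + 2` in `ℝ`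
  have hτR : (τ : ℝ) ≤ (j : ℝ) / ((r : ℝ) + 1) + 2 := by
    rw [hτ]; push_cast
    have := Nat.cast_div_le (m := j) (n := r + 1) (α := ℝ)
    push_cast at this
    linarith
  -- `j/(r+1) log 2 ≤ 0.2 L`
  have hl0 : 0 < Real.log 2 := Real.log_pos (by norm_num)
  have hl1 := Real.log_two_lt_d9
  have hjr : (j : ℝ) / ((r : ℝ) + 1) * Real.log 2 ≤ 0.2 * L := by
    rw [div_mul_eq_mul_div, div_le_iff₀ hr0, hj]
    nlinarith
  have h2τ : ((2 ^ τ : ℕ) : ℝ) ≤ 4 * Real.exp (0.2 * L) := by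
    push_cast
    have e2 : (2 : ℝ) ^ τ = Real.exp ((τ : ℝ) * Real.log 2) := by
      rw [Real.exp_nat_mul, Real.exp_log (by norm_num)]
    rw [e2]
    have h4 : (4 : ℝ) = Real.exp (2 * Real.log 2) := by
      rw [show (2 : ℝ) * Real.log 2 = Real.log 2 + Real.log 2 by ring, Real.exp_add,
        Real.exp_log (by norm_num)]
      norm_num
    rw [h4, ← Real.exp_add]
    apply Real.exp_le_exp.2
    have : (τ : ℝ) * Real.log 2 ≤ ((j : ℝ) / ((r : ℝ) + 1) + 2) * Real.log 2 :=
      mul_le_mul_of_nonneg_right hτR hl0.le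
    nlinarith
  have haR : (a : ℝ) ≤ Real.exp (0.39 * L) := by rw [ha]; exact Nat.floor_le (by positivity)
  have ha0 : (0 : ℝ) ≤ a := by positivity
  have ha2 : (a : ℝ) ^ 2 ≤ Real.exp (0.78 * L) := by
    calc (a : ℝ) ^ 2 ≤ Real.exp (0.39 * L) ^ 2 := pow_le_pow_left₀ ha0 haR 2
      _ = Real.exp (0.78 * L) := by rw [← Real.exp_nat_mul]; ring_nf
  have h20 : (0 : ℝ) ≤ ((2 ^ τ : ℕ) : ℝ) := by positivity
  calc 2 * ((2 ^ τ : ℕ) : ℝ) * (a : ℝ) ^ 2 ≤ 2 * (4 * Real.exp (0.2 * L)) * Real.exp (0.78 * L) := by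
        apply mul_le_mul (mul_le_mul_of_nonneg_left h2τ (by norm_num)) ha2 (by positivity) (by positivity)
    _ = 8 * Real.exp (0.98 * L) := by
        rw [show (8 : ℝ) * Real.exp (0.98 * L) = 8 * (Real.exp (0.2 * L) * Real.exp (0.78 * L)) by
          rw [← Real.exp_add]; ring_nf]
        ring

/-! ### The good indices -/

/-- `a = ⌊e^{0.39L}⌋ ≥ e^{0.38L}` for `L ≥ 100`. [folklore] -/
theorem exp_le_a {a : ℕ} {L : ℝ} (hL : 100 ≤ L) (ha : a = ⌊Real.exp (0.39 * L)⌋₊) :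
    Real.exp (0.38 * L) ≤ a := by
  have hfl : Real.exp (0.39 * L) < (a : ℝ) + 1 := by rw [ha]; exact Nat.lt_floor_add_one _
  have hsplit : Real.exp (0.39 * L) = Real.exp (0.38 * L) * Real.exp (0.01 * L) := by
    rw [← Real.exp_add]; ring_nf
  have h01 : 1 + 0.01 * L ≤ Real.exp (0.01 * L) := by
    have := Real.add_one_le_exp (0.01 * L); linarith
  have hex0 : 1 ≤ Real.exp (0.38 * L) := Real.one_le_exp (by positivity)
  have hex1 : Real.exp (0.38 * L) * (1 + 0.01 * L) ≤ Real.exp (0.38 * L) * Real.exp (0.01 * L) :=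
    mul_le_mul_of_nonneg_left h01 (by positivity)
  have hex2 : Real.exp (0.38 * L) * (1 + 0.01 * L) = Real.exp (0.38 * L) + Real.exp (0.38 * L) * (0.01 * L) := by
    ring
  have hex3 : 1 * 1 ≤ Real.exp (0.38 * L) * (0.01 * L) :=
    mul_le_mul hex0 (by linarith) (by norm_num) (by positivity)
  linarith

/-- (G2) `2^e ≤ k a^m` from `e log 2 ≤ 0.61 YL`, `m > 2Y`, `a ≥ e^{0.38L}`, `k ≥ 1`. [folklore] -/
theorem two_pow_le_k_mul_a_pow {e m a k : ℕ} {L Y : ℝ} (hL0 : 0 < L) (hY0 : 0 ≤ Y) (hm2Y : 2 * Y < m)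
    (helog : (e : ℝ) * Real.log 2 ≤ 0.61 * (Y * L)) (ha38 : Real.exp (0.38 * L) ≤ a) (hk1 : 1 ≤ k) :
    (2 : ℝ) ^ e ≤ (k : ℝ) * (a : ℝ) ^ m := by
  have h2e : (2 : ℝ) ^ e = Real.exp ((e : ℝ) * Real.log 2) := by
    rw [Real.exp_nat_mul, Real.exp_log (by norm_num)]
  have ha0 : (0 : ℝ) < a := lt_of_lt_of_le (Real.exp_pos _) ha38
  have hk1R : (1 : ℝ) ≤ k := by exact_mod_cast hk1
  have ham : Real.exp (0.38 * L) ^ m ≤ (a : ℝ) ^ m := pow_le_pow_left₀ (Real.exp_pos _).le ha38 m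
  rw [← Real.exp_nat_mul] at ham
  have hmL : 2 * Y * L ≤ (m : ℝ) * L := mul_le_mul_of_nonneg_right hm2Y.le hL0.le
  have h1 : (e : ℝ) * Real.log 2 ≤ (m : ℝ) * (0.38 * L) := by
    have e1 : (m : ℝ) * (0.38 * L) = 0.38 * ((m : ℝ) * L) := by ring
    have e2 : 2 * Y * L = 2 * (Y * L) := by ring
    rw [e1]; rw [e2] at hmL
    have hYL : 0 ≤ Y * L := by positivity
    linarith
  calc (2 : ℝ) ^ e = Real.exp ((e : ℝ) * Real.log 2) := h2e
    _ ≤ Real.exp ((m : ℝ) * (0.38 * L)) := Real.exp_le_exp.2 h1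
    _ ≤ (a : ℝ) ^ m := ham
    _ ≤ (k : ℝ) * (a : ℝ) ^ m := le_mul_of_one_le_left (by positivity) hk1R

/-- (G3) `(4 + log 2^e)/2^e ≤ θ*(L,Y) = L e^{21Y − 0.3YL}` from `0.3YL − 5Y ≤ e log 2 ≤ YL` (`L ≥ 4`, `Y ≥ 0`).
[cite: Ivic1985, p. 158] -/
theorem theta_condition {e : ℕ} {L Y : ℝ} (hL4 : 4 ≤ L) (hY0 : 0 ≤ Y)
    (helog_lo : 0.3 * (Y * L) - 5 * Y ≤ (e : ℝ) * Real.log 2) (helog_j : (e : ℝ) * Real.log 2 ≤ Y * L) :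
    (4 + Real.log ((2 : ℝ) ^ e)) / (2 : ℝ) ^ e ≤ thetaStar L Y := by
  have hL0 : 0 < L := by linarith
  have h2e : (2 : ℝ) ^ e = Real.exp ((e : ℝ) * Real.log 2) := by
    rw [Real.exp_nat_mul, Real.exp_log (by norm_num)]
  have h2e0 : (0 : ℝ) < (2 : ℝ) ^ e := by positivity
  rw [div_le_iff₀ h2e0]
  have hnum : 4 + Real.log ((2 : ℝ) ^ e) ≤ L * Real.exp (16 * Y) := by
    rw [Real.log_pow]
    have h2 : 1 + 16 * Y ≤ Real.exp (16 * Y) := by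
      have := Real.add_one_le_exp (16 * Y); linarith
    have h3 : L * (1 + 16 * Y) ≤ L * Real.exp (16 * Y) := mul_le_mul_of_nonneg_left h2 hL0.le
    have h4 : L * (1 + 16 * Y) = L + 16 * (Y * L) := by ring
    have h5 : 0 ≤ Y * L := by positivity
    linarith
  have hden : Real.exp (0.3 * (Y * L) - 5 * Y) ≤ (2 : ℝ) ^ e := by
    rw [h2e]
    exact Real.exp_le_exp.2 helog_lo
  have hθ : L * Real.exp (16 * Y) ≤ thetaStar L Y * (2 : ℝ) ^ e := by
    unfold thetaStar
    have hpos : 0 ≤ L * Real.exp (21 * Y - 0.3 * Y * L) := by positivity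
    calc L * Real.exp (16 * Y) = L * Real.exp (21 * Y - 0.3 * Y * L) * Real.exp (0.3 * (Y * L) - 5 * Y) := by
          rw [mul_assoc, ← Real.exp_add]; ring_nf
      _ ≤ L * Real.exp (21 * Y - 0.3 * Y * L) * (2 : ℝ) ^ e := mul_le_mul_of_nonneg_left hden hpos
  linarith

/-- **The good indices, core inequalities**: for `⌊2Y⌋ < m ≤ ⌊3.5Y⌋`: `2Y < m ≤ 3.5Y`, `τm < j` and
`0.3YL − 5Y ≤ e_m log 2 ≤ 0.61 YL` for `e_m = j + v₂(m) − τm` (via `τ ∈ [j/(r+1)+1, j/(r+1)+2]`,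
`m/(r+1) ∈ [0.39, 0.7]`). [cite: Ivic1985, Theorem 6.2 (proof, pp. 156–158)] -/
theorem params_good_core {j r τ M₂ M₃ : ℕ} {L Y : ℝ} (hY : 10 ≤ Y) (hL : (10 : ℝ) ^ 6 * Y ^ 2 ≤ L)
    (hj : (j : ℝ) * Real.log 2 = Y * L) (hr : r = ⌊5.01 * Y⌋₊) (hτ : τ = j / (r + 1) + 2)
    (hM₂ : M₂ = ⌊2 * Y⌋₊) (hM₃ : M₃ = ⌊3.5 * Y⌋₊) (m : ℕ) (hm1 : M₂ < m) (hm2 : m ≤ M₃) :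
    2 * Y < m ∧ (m : ℝ) ≤ 3.5 * Y ∧ τ * m < j ∧
      0.3 * (Y * L) - 5 * Y ≤ ((j + padicValNat 2 m - τ * m : ℕ) : ℝ) * Real.log 2 ∧
      ((j + padicValNat 2 m - τ * m : ℕ) : ℝ) * Real.log 2 ≤ 0.61 * (Y * L) := by
  obtain ⟨hL8, hj1, -, -⟩ := j_bounds hY hL hj
  have hY0 : 0 < Y := by linarith
  have hl0 : 0 < Real.log 2 := Real.log_pos (by norm_num)
  have hl1 := Real.log_two_lt_d9
  have hYL8 : Y * (10 : ℝ) ^ 8 ≤ Y * L := mul_le_mul_of_nonneg_left hL8 hY0.le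
  -- `m ∈ (2Y, 3.5Y]`
  have hm2Y : 2 * Y < m := by
    have h := Nat.lt_floor_add_one (2 * Y)
    rw [← hM₂] at h
    have : (M₂ : ℝ) + 1 ≤ m := by exact_mod_cast hm1
    linarith
  have hm35 : (m : ℝ) ≤ 3.5 * Y := by
    have h : (M₃ : ℝ) ≤ 3.5 * Y := by rw [hM₃]; exact Nat.floor_le (by positivity)
    have : (m : ℝ) ≤ M₃ := by exact_mod_cast hm2
    linarith
  have hm0 : (0 : ℝ) < m := by linarith
  have hm1' : 1 ≤ m := by
    have : (1 : ℝ) ≤ m := by linarith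
    exact_mod_cast this
  -- `r + 1 ∈ (5.01Y, 5.01Y + 1]`
  have hr_le : (r : ℝ) ≤ 5.01 * Y := by rw [hr]; exact Nat.floor_le (by positivity)
  have hr_gt : 5.01 * Y < (r : ℝ) + 1 := by rw [hr]; exact Nat.lt_floor_add_one _
  have hr0 : (0 : ℝ) < (r : ℝ) + 1 := by positivity
  -- `ρ = j/(r+1)`, `τ ∈ [ρ + 1, ρ + 2]`
  set ρ : ℝ := (j : ℝ) / ((r : ℝ) + 1) with hρ
  have hρ0 : 0 ≤ ρ := by positivity
  have hρj : ρ * ((r : ℝ) + 1) = j := by rw [hρ]; field_simp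
  have hτhi : (τ : ℝ) ≤ ρ + 2 := by
    rw [hτ]; push_cast
    have := Nat.cast_div_le (m := j) (n := r + 1) (α := ℝ)
    push_cast at this
    linarith
  have hτ1 : 1 ≤ τ := Nat.one_le_iff_ne_zero.2 (by rw [hτ]; exact Nat.succ_ne_zero _)
  have hτlo : ρ + 1 ≤ τ := by
    have h1 : j < (r + 1) * (j / (r + 1) + 1) := Nat.lt_mul_div_succ j (Nat.succ_pos r)
    have h2 : j / (r + 1) + 1 = τ - 1 := by rw [hτ]; rfl
    rw [h2] at h1
    have h3 : (j : ℝ) < ((r : ℝ) + 1) * ((τ : ℝ) - 1) := by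
      have : ((j : ℕ) : ℝ) < (((r + 1) * (τ - 1) : ℕ) : ℝ) := by exact_mod_cast h1
      push_cast [Nat.cast_sub hτ1] at this
      linarith
    by_contra hcon
    have hcon' : (τ : ℝ) - 1 < ρ := by linarith
    have h4 : ((τ : ℝ) - 1) * ((r : ℝ) + 1) < ρ * ((r : ℝ) + 1) := mul_lt_mul_of_pos_right hcon' hr0
    linarith
  -- `ρ m ∈ [0.39 j, 0.7 j]`
  have hρm_hi : ρ * m ≤ 0.7 * j := by
    have h1 : (m : ℝ) ≤ 0.7 * ((r : ℝ) + 1) := by linarith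
    have h2 : ρ * m ≤ ρ * (0.7 * ((r : ℝ) + 1)) := mul_le_mul_of_nonneg_left h1 hρ0
    have h3 : ρ * (0.7 * ((r : ℝ) + 1)) = 0.7 * j := by rw [← hρj]; ring
    linarith
  have hρm_lo : 0.39 * (j : ℝ) ≤ ρ * m := by
    have h1 : 0.39 * ((r : ℝ) + 1) ≤ (m : ℝ) := by linarith
    have h2 : ρ * (0.39 * ((r : ℝ) + 1)) ≤ ρ * m := mul_le_mul_of_nonneg_left h1 hρ0
    have h3 : ρ * (0.39 * ((r : ℝ) + 1)) = 0.39 * j := by rw [← hρj]; ring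
    linarith
  have hτm_hi : (τ : ℝ) * m ≤ 0.7 * j + 7 * Y := by
    have h1 : (τ : ℝ) * m ≤ (ρ + 2) * m := mul_le_mul_of_nonneg_right hτhi hm0.le
    have h2 : (ρ + 2) * (m : ℝ) = ρ * m + 2 * m := by ring
    linarith
  have hτm_lo : 0.39 * (j : ℝ) + m ≤ (τ : ℝ) * m := by
    have h1 : (ρ + 1) * m ≤ (τ : ℝ) * m := mul_le_mul_of_nonneg_right hτlo hm0.le
    have h2 : (ρ + 1) * (m : ℝ) = ρ * m + m := by ring
    linarith
  -- (G1) `τ m < j`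
  have hG1R : (τ : ℝ) * m < j := by linarith
  have hG1 : τ * m < j := by exact_mod_cast hG1R
  -- the exponent
  have hv : padicValNat 2 m < m := padicValNat_two_lt_self hm1'
  have hvR : ((padicValNat 2 m : ℕ) : ℝ) ≤ m := by exact_mod_cast hv.le
  have hv0 : (0 : ℝ) ≤ ((padicValNat 2 m : ℕ) : ℝ) := Nat.cast_nonneg _
  have heR : ((j + padicValNat 2 m - τ * m : ℕ) : ℝ) = (j : ℝ) + (padicValNat 2 m : ℕ) - (τ : ℝ) * m := by
    rw [Nat.cast_sub (by omega)]; push_cast; ring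
  have he_hi : ((j + padicValNat 2 m - τ * m : ℕ) : ℝ) ≤ 0.61 * j := by rw [heR]; linarith
  have he_lo : 0.3 * (j : ℝ) - 7 * Y ≤ ((j + padicValNat 2 m - τ * m : ℕ) : ℝ) := by rw [heR]; linarith
  refine ⟨hm2Y, hm35, hG1, ?_, ?_⟩
  · have h1 := mul_le_mul_of_nonneg_right he_lo hl0.le
    have h2 : (0.3 * (j : ℝ) - 7 * Y) * Real.log 2 = 0.3 * ((j : ℝ) * Real.log 2) - 7 * (Y * Real.log 2) := by
      ring
    rw [h2, hj] at h1
    have h3 : Y * Real.log 2 ≤ Y * 0.7 := mul_le_mul_of_nonneg_left (by linarith) hY0.le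
    linarith
  · have := mul_le_mul_of_nonneg_right he_hi hl0.le
    rw [mul_assoc, hj] at this
    exact this

/-- ★ **The good indices** `⌊2Y⌋ < m ≤ ⌊3.5Y⌋`: `τm < j + v₂(m)`, `2^{e_m} ≤ k a^m` and
`(4 + log 2^{e_m})/2^{e_m} ≤ θ*(L,Y)` for `e_m = j + v₂(m) − τm`. [cite: Ivic1985, Theorem 6.2 (proof, pp. 156–158)] -/
theorem params_good {j r τ a k M₂ M₃ : ℕ} {L Y : ℝ} (hY : 10 ≤ Y) (hL : (10 : ℝ) ^ 6 * Y ^ 2 ≤ L)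
    (hj : (j : ℝ) * Real.log 2 = Y * L) (hr : r = ⌊5.01 * Y⌋₊) (hτ : τ = j / (r + 1) + 2)
    (ha : a = ⌊Real.exp (0.39 * L)⌋₊) (hk : k = 5 * r ^ 2) (hM₂ : M₂ = ⌊2 * Y⌋₊) (hM₃ : M₃ = ⌊3.5 * Y⌋₊)
    (m : ℕ) (hm1 : M₂ < m) (hm2 : m ≤ M₃) :
    τ * m < j + padicValNat 2 m ∧
      (2 : ℝ) ^ (j + padicValNat 2 m - τ * m) ≤ (k : ℝ) * (a : ℝ) ^ m ∧
      (4 + Real.log (2 ^ (j + padicValNat 2 m - τ * m))) / 2 ^ (j + padicValNat 2 m - τ * m) ≤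
        thetaStar L Y := by
  obtain ⟨hm2Y, -, hG1, helo, hehi⟩ := params_good_core hY hL hj hr hτ hM₂ hM₃ m hm1 hm2
  obtain ⟨hL8, -, -, -⟩ := j_bounds hY hL hj
  have hY0 : 0 < Y := by linarith
  have hL0 : 0 < L := by linarith
  have hr50 : 50 ≤ r := (params_basic hY hL hj hr hτ ha hM₂ hM₃).2.2.1
  have hk1 : 1 ≤ k := by rw [hk]; nlinarith
  have hehi' : ((j + padicValNat 2 m - τ * m : ℕ) : ℝ) * Real.log 2 ≤ Y * L := by
    have : 0 ≤ Y * L := by positivity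
    linarith
  refine ⟨by omega, ?_, ?_⟩
  · exact two_pow_le_k_mul_a_pow hL0 hY0.le hm2Y hehi (exp_le_a (by linarith) ha) hk1
  · exact theta_condition (by linarith) hY0.le helo hehi'

end Summit.ValiantsHypothesis.ValiantsHypothesis.Theorems.LiouvilleSarnak.AlignedTypeI.CharactersModTwoN
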